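import Mathlib
import HarnessLib
import Summits.ValiantsHypothesis.ValiantsHypothesis.Theorems.MonotoneRestorationOrbitRestorationQPSupportBlockSpan

/-!
# Block eigen-scalars are signs (SPAN currency; twisted residue of the `ΠΣ` sub-rung)

Route MonotoneRestoration, crux `OrbitRestorationQP` (stmt-ValiantsHypothesis-18293), SPAN-currency lane of the open
sub-rung A_∞ (`stub_sigmaPiSigmaValue`), `ΠΣ` part.  Helper (`--supports`), def-free.  Item R1 of the census
`BLOCK-LANE-g7g5.md` §3.

A placed polynomial local form with `U`, `B = P(x_{φ a, ψ b}, R_{φ a}, C_{ψ b}, U)` (core placed injectively by `φ, ψ`),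
on which EVERY row/column renaming preserving the placed rows `range φ` and columns `range ψ` acts by a scalar (as is
the case for the support blocks of a matrix-symmetric affine product, by block transport), has only the eigen-scalars
`±1`: the scalar is a multiplicative character of `Sym(Fin r) × Sym(Fin c)` (the renaming acts through the induced core
permutations, `CorePatterns.rename_rowCol_aevalU_atoms`), and characters of symmetric groups are signs
(`ProductAction.eq_one_or_eq_neg_one`).

* `exists_corePerm_of_preserves` — a renaming preserving `range φ` induces a permutation `α` of the core with
  `σ ∘ φ = φ ∘ α`;
* `rename_rowCol_aevalU_eq_of_comp` — the renamed form depends only on the induced core permutations;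
* **`blockScalar_eq_one_or_eq_neg_one`** — THE SIGN LEMMA: under the hypotheses above, `(σ,τ) · B = u · B ⇒ u = ±1`.

Consequence (lane note): the block-untwisted hypothesis of `NormalisedFactors.prod_mem_narrowSpan_of_supportBlockUntwisted`
fails only through SIGN twists, and squares of blocks are untwisted.  No registered stub is closed; the crux and
VP ≠ VNP are not moved. [folklore]
-/

noncomputable section

-- `Summit.ValiantsHypothesis.ValiantsHypothesis.…` is the tree's single-conjunct layout (Sub = Summit).
set_option linter.dupNamespace false

namespace Summit.ValiantsHypothesis.ValiantsHypothesis.Theorems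

namespace NormalisedFactors

open MvPolynomial Finset Equiv ProductAction

variable {n : ℕ}

/-- **A renaming preserving the placed rows induces a permutation of the core.** [folklore] -/
theorem exists_corePerm_of_preserves {r : ℕ} (e : Fin r → Fin n) (he : Function.Injective e) (σ : Perm (Fin n))
    (hσ : ∀ i, ∃ j, σ (e i) = e j) : ∃ α : Perm (Fin r), ⇑σ ∘ e = e ∘ ⇑α := by
  classical
  choose j hj using hσ
  have hinj : Function.Injective j := by
    intro i i' h
    apply he
    apply σ.injective
    rw [hj i, hj i', h]
  refine ⟨Equiv.ofBijective j (Finite.injective_iff_bijective.1 hinj), funext fun i => ?_⟩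
  simp only [Function.comp_apply, Equiv.ofBijective_apply]
  exact hj i

/-- **The renamed placed form depends only on the induced core permutations.** [folklore] -/
theorem rename_rowCol_aevalU_eq_of_comp {r c : ℕ} (P : MvPolynomial (((Fin r × Fin c) ⊕ (Fin r ⊕ Fin c)) ⊕ Unit) ℂ)
    (eA : Fin r → Fin n) (eT : Fin c → Fin n) (σ τ : Perm (Fin n)) (α : Perm (Fin r)) (β : Perm (Fin c))
    (hσ : ⇑σ ∘ eA = eA ∘ ⇑α) (hτ : ⇑τ ∘ eT = eT ∘ ⇑β) :
    rename (fun Q : Fin n × Fin n => (σ Q.1, τ Q.2))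
      (aeval (Sum.elim (Sum.elim (fun ab : Fin r × Fin c => (X (eA ab.1, eT ab.2) : MvPolynomial (Fin n × Fin n) ℂ))
        (Sum.elim (fun a : Fin r => ∑ j : Fin n, (X (eA a, j) : MvPolynomial (Fin n × Fin n) ℂ))
          (fun b : Fin c => ∑ j : Fin n, (X (j, eT b) : MvPolynomial (Fin n × Fin n) ℂ))))
        (fun _ : Unit => ∑ i : Fin n, ∑ j : Fin n, (X (i, j) : MvPolynomial (Fin n × Fin n) ℂ))) P) =
      aeval (Sum.elim (Sum.elim
        (fun ab : Fin r × Fin c => (X ((eA ∘ ⇑α) ab.1, (eT ∘ ⇑β) ab.2) : MvPolynomial (Fin n × Fin n) ℂ))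
        (Sum.elim (fun a : Fin r => ∑ j : Fin n, (X ((eA ∘ ⇑α) a, j) : MvPolynomial (Fin n × Fin n) ℂ))
          (fun b : Fin c => ∑ j : Fin n, (X (j, (eT ∘ ⇑β) b) : MvPolynomial (Fin n × Fin n) ℂ))))
        (fun _ : Unit => ∑ i : Fin n, ∑ j : Fin n, (X (i, j) : MvPolynomial (Fin n × Fin n) ℂ))) P := by
  rw [CorePatterns.rename_rowCol_aevalU_atoms, hσ, hτ]

/-- **THE SIGN LEMMA: block eigen-scalars are `±1`.**  Let `B = P(x_{φ a, ψ b}, R_{φ a}, C_{ψ b}, U) ≠ 0` be a placed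
polynomial local form with `U` (injective placements `φ, ψ`) on which every renaming preserving `range φ` and `range ψ`
acts by a scalar.  Then every such scalar is `1` or `−1`. [folklore] -/
theorem blockScalar_eq_one_or_eq_neg_one {r c : ℕ} (P : MvPolynomial (((Fin r × Fin c) ⊕ (Fin r ⊕ Fin c)) ⊕ Unit) ℂ)
    (eA : Fin r → Fin n) (eT : Fin c → Fin n) (heA : Function.Injective eA) (heT : Function.Injective eT)
    (hB0 : aeval (Sum.elim (Sum.elim (fun ab : Fin r × Fin c => (X (eA ab.1, eT ab.2) : MvPolynomial (Fin n × Fin n) ℂ))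
        (Sum.elim (fun a : Fin r => ∑ j : Fin n, (X (eA a, j) : MvPolynomial (Fin n × Fin n) ℂ))
          (fun b : Fin c => ∑ j : Fin n, (X (j, eT b) : MvPolynomial (Fin n × Fin n) ℂ))))
        (fun _ : Unit => ∑ i : Fin n, ∑ j : Fin n, (X (i, j) : MvPolynomial (Fin n × Fin n) ℂ))) P ≠ 0)
    (hscal : ∀ σ τ : Perm (Fin n), (∀ i, ∃ j, σ (eA i) = eA j) → (∀ i, ∃ j, τ (eT i) = eT j) → ∃ u : ℂ,
      rename (fun Q : Fin n × Fin n => (σ Q.1, τ Q.2))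
        (aeval (Sum.elim (Sum.elim (fun ab : Fin r × Fin c => (X (eA ab.1, eT ab.2) : MvPolynomial (Fin n × Fin n) ℂ))
          (Sum.elim (fun a : Fin r => ∑ j : Fin n, (X (eA a, j) : MvPolynomial (Fin n × Fin n) ℂ))
            (fun b : Fin c => ∑ j : Fin n, (X (j, eT b) : MvPolynomial (Fin n × Fin n) ℂ))))
          (fun _ : Unit => ∑ i : Fin n, ∑ j : Fin n, (X (i, j) : MvPolynomial (Fin n × Fin n) ℂ))) P) =
      C u * aeval (Sum.elim (Sum.elim (fun ab : Fin r × Fin c => (X (eA ab.1, eT ab.2) : MvPolynomial (Fin n × Fin n) ℂ))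
          (Sum.elim (fun a : Fin r => ∑ j : Fin n, (X (eA a, j) : MvPolynomial (Fin n × Fin n) ℂ))
            (fun b : Fin c => ∑ j : Fin n, (X (j, eT b) : MvPolynomial (Fin n × Fin n) ℂ))))
          (fun _ : Unit => ∑ i : Fin n, ∑ j : Fin n, (X (i, j) : MvPolynomial (Fin n × Fin n) ℂ))) P)
    (σ τ : Perm (Fin n)) (hσ : ∀ i, ∃ j, σ (eA i) = eA j) (hτ : ∀ i, ∃ j, τ (eT i) = eT j) (u : ℂ)
    (hu : rename (fun Q : Fin n × Fin n => (σ Q.1, τ Q.2))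
        (aeval (Sum.elim (Sum.elim (fun ab : Fin r × Fin c => (X (eA ab.1, eT ab.2) : MvPolynomial (Fin n × Fin n) ℂ))
          (Sum.elim (fun a : Fin r => ∑ j : Fin n, (X (eA a, j) : MvPolynomial (Fin n × Fin n) ℂ))
            (fun b : Fin c => ∑ j : Fin n, (X (j, eT b) : MvPolynomial (Fin n × Fin n) ℂ))))
          (fun _ : Unit => ∑ i : Fin n, ∑ j : Fin n, (X (i, j) : MvPolynomial (Fin n × Fin n) ℂ))) P) =
      C u * aeval (Sum.elim (Sum.elim (fun ab : Fin r × Fin c => (X (eA ab.1, eT ab.2) : MvPolynomial (Fin n × Fin n) ℂ))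
          (Sum.elim (fun a : Fin r => ∑ j : Fin n, (X (eA a, j) : MvPolynomial (Fin n × Fin n) ℂ))
            (fun b : Fin c => ∑ j : Fin n, (X (j, eT b) : MvPolynomial (Fin n × Fin n) ℂ))))
          (fun _ : Unit => ∑ i : Fin n, ∑ j : Fin n, (X (i, j) : MvPolynomial (Fin n × Fin n) ℂ))) P) :
    u = 1 ∨ u = -1 := by
  classical
  -- abbreviations
  set B := aeval (Sum.elim (Sum.elim (fun ab : Fin r × Fin c => (X (eA ab.1, eT ab.2) : MvPolynomial (Fin n × Fin n) ℂ))
        (Sum.elim (fun a : Fin r => ∑ j : Fin n, (X (eA a, j) : MvPolynomial (Fin n × Fin n) ℂ))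
          (fun b : Fin c => ∑ j : Fin n, (X (j, eT b) : MvPolynomial (Fin n × Fin n) ℂ))))
        (fun _ : Unit => ∑ i : Fin n, ∑ j : Fin n, (X (i, j) : MvPolynomial (Fin n × Fin n) ℂ))) P with hBdef
  set V : Perm (Fin r) → Perm (Fin c) → MvPolynomial (Fin n × Fin n) ℂ := fun α β =>
    aeval (Sum.elim (Sum.elim
        (fun ab : Fin r × Fin c => (X ((eA ∘ ⇑α) ab.1, (eT ∘ ⇑β) ab.2) : MvPolynomial (Fin n × Fin n) ℂ))
        (Sum.elim (fun a : Fin r => ∑ j : Fin n, (X ((eA ∘ ⇑α) a, j) : MvPolynomial (Fin n × Fin n) ℂ))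
          (fun b : Fin c => ∑ j : Fin n, (X (j, (eT ∘ ⇑β) b) : MvPolynomial (Fin n × Fin n) ℂ))))
        (fun _ : Unit => ∑ i : Fin n, ∑ j : Fin n, (X (i, j) : MvPolynomial (Fin n × Fin n) ℂ))) P with hVdef
  -- renaming by extensions of (α, β) gives V α β
  have hV : ∀ (σ' τ' : Perm (Fin n)) (α : Perm (Fin r)) (β : Perm (Fin c)),
      ⇑σ' ∘ eA = eA ∘ ⇑α → ⇑τ' ∘ eT = eT ∘ ⇑β →
      rename (fun Q : Fin n × Fin n => (σ' Q.1, τ' Q.2)) B = V α β := by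
    intro σ' τ' α β h1 h2
    rw [hBdef, hVdef]
    exact rename_rowCol_aevalU_eq_of_comp P eA eT σ' τ' α β h1 h2
  -- extensions exist and preserve the ranges
  have hext : ∀ (α : Perm (Fin r)) (β : Perm (Fin c)), ∃ σ' τ' : Perm (Fin n),
      ⇑σ' ∘ eA = eA ∘ ⇑α ∧ ⇑τ' ∘ eT = eT ∘ ⇑β := by
    intro α β
    obtain ⟨σ', hσ'⟩ := CorePatterns.exists_perm_comp_eq eA (eA ∘ ⇑α) heA (heA.comp α.injective)
    obtain ⟨τ', hτ'⟩ := CorePatterns.exists_perm_comp_eq eT (eT ∘ ⇑β) heT (heT.comp β.injective)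
    exact ⟨σ', τ', hσ', hτ'⟩
  have hpres : ∀ (σ' : Perm (Fin n)) {m : ℕ} (e : Fin m → Fin n) (γ : Perm (Fin m)), ⇑σ' ∘ e = e ∘ ⇑γ →
      ∀ i, ∃ j, σ' (e i) = e j := by
    intro σ' m e γ h i
    exact ⟨γ i, by simpa using congrFun h i⟩
  -- every V α β is a scalar multiple of B
  have hVscal : ∀ (α : Perm (Fin r)) (β : Perm (Fin c)), ∃ v : ℂ, V α β = C v * B := by
    intro α β
    obtain ⟨σ', τ', h1, h2⟩ := hext α β
    obtain ⟨v, hv⟩ := hscal σ' τ' (hpres σ' eA α h1) (hpres τ' eT β h2)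
    exact ⟨v, by rw [← hV σ' τ' α β h1 h2]; exact hv⟩
  choose χ hχ using hVscal
  -- uniqueness of scalars
  have huniq : ∀ v w : ℂ, C v * B = C w * B → v = w := by
    intro v w h
    exact C_injective _ _ (mul_right_cancel₀ hB0 h)
  -- χ 1 1 = 1
  have hV11 : V 1 1 = B := by
    rw [hVdef, hBdef]
    rfl
  have hχ11 : χ 1 1 = 1 := huniq _ _ (by rw [← hχ 1 1, hV11, C_1, one_mul])
  -- multiplicativity: V (α₁ * α₂) (β₁ * β₂) = χ α₂ β₂ • V α₁ β₁ renamed ... via extensions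
  have hmul : ∀ (α₁ α₂ : Perm (Fin r)) (β₁ β₂ : Perm (Fin c)),
      χ (α₁ * α₂) (β₁ * β₂) = χ α₁ β₁ * χ α₂ β₂ := by
    intro α₁ α₂ β₁ β₂
    obtain ⟨σ₁, τ₁, h1, h1'⟩ := hext α₁ β₁
    obtain ⟨σ₂, τ₂, h2, h2'⟩ := hext α₂ β₂
    have h12 : ⇑(σ₁ * σ₂) ∘ eA = eA ∘ ⇑(α₁ * α₂) := by
      rw [Perm.coe_mul, Perm.coe_mul, Function.comp_assoc, h2, ← Function.comp_assoc, h1, Function.comp_assoc]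
    have h12' : ⇑(τ₁ * τ₂) ∘ eT = eT ∘ ⇑(β₁ * β₂) := by
      rw [Perm.coe_mul, Perm.coe_mul, Function.comp_assoc, h2', ← Function.comp_assoc, h1', Function.comp_assoc]
    apply huniq
    rw [← hχ, ← hV (σ₁ * σ₂) (τ₁ * τ₂) _ _ h12 h12', ← rename_rowCol_mul, hV σ₂ τ₂ α₂ β₂ h2 h2', hχ α₂ β₂,
      map_mul, rename_C, hV σ₁ τ₁ α₁ β₁ h1 h1', hχ α₁ β₁, ← mul_assoc, ← map_mul, mul_comm (χ α₂ β₂)]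
  -- the row character and the column character are signs
  have hrowχ : ∀ α : Perm (Fin r), χ α 1 = 1 ∨ χ α 1 = -1 := by
    refine ProductAction.eq_one_or_eq_neg_one (fun α => χ α 1) hχ11 fun a b => ?_
    have h := hmul a b 1 1
    rwa [mul_one] at h
  have hcolχ : ∀ β : Perm (Fin c), χ 1 β = 1 ∨ χ 1 β = -1 := by
    refine ProductAction.eq_one_or_eq_neg_one (fun β => χ 1 β) hχ11 fun a b => ?_
    have h := hmul 1 1 a b
    rwa [mul_one] at h
  -- the given renaming
  obtain ⟨α, hα⟩ := exists_corePerm_of_preserves eA heA σ hσ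
  obtain ⟨β, hβ⟩ := exists_corePerm_of_preserves eT heT τ hτ
  have huχ : u = χ α β := by
    apply huniq
    rw [← hu, hV σ τ α β hα hβ, hχ]
  have hsplit : χ α β = χ α 1 * χ 1 β := by
    have h := hmul α 1 1 β
    rwa [mul_one, one_mul] at h
  rw [huχ, hsplit]
  rcases hrowχ α with h1 | h1 <;> rcases hcolχ β with h2 | h2 <;> simp [h1, h2]

end NormalisedFactors

end Summit.ValiantsHypothesis.ValiantsHypothesis.Theorems

end
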